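import Literature.MathematicalPhysics.QuantumFieldTheory.Balaban1983to89.Node00.Record13Chi
import Literature.MathematicalPhysics.QuantumFieldTheory.Balaban1983to89.Node00.Record13Carriers

/-!
# NODE 00 — χ-GENERIC RE-ISSUE (WORK ORDER RC-1 «RE-CENTRE THE RECORD», director-ym №462 (B) ∕ №467 (D)) of the **W-PART** of dag-n10-d's
# `Node00/Record13Carriers`: the [IV] carrier bundle of record at Stage 13 in the β-slot `χ` — `WOfRecord₁₃Chi θ χ λ P` — with its `rfl` faces, its
# `rfl` behaviour under the seven carrier pins, the receipt «at `χ := chiβOfRecord₁₃ θ` it IS `WOfRecord₁₃ θ`» and the instance at the re-centred cut-off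
# `WOfRecord₁₃Ax θ := WOfRecord₁₃Chi θ (chiβOfRecord₁₃Ax θ)`

CITATION HEADER.  [IV] = [Balaban1989LargeFieldI] (Commun. Math. Phys. **122** (1989) 175–202): (0.2)–(0.6) p.176 (the 𝐑-operation on the level-`k+1` expansion:
the pieces, the `p–p′` selector, the fibres), Prop. 1 p.194, (1.89) p.198, (1.100)–(1.102) p.201 (the three residual letters the bundle carries); [III] =
[Balaban1988Convergent] (Commun. Math. Phys. **119** (1988) 243–285): (2.18) p.257 and (3.25) p.270 (the represented tower `rep_k` ∕ `T rep_k` of record); [I] =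
[Balaban1987RG1] (Commun. Math. Phys. **109** (1987) 249–301): (2.9) p.266 (the fluctuation cut-off whose CENTRE is the point of RC-1), (0.17)–(0.20) pp.255–256
(the generated coupling history).

WHY (cell `pub-ymgap`, seat `pub-ymgap-dag-n12-d` g36, N12 [B15] s2 «knit at the record»; count-neutral helper of K1ᴬ `stmt-QuantumFields-27239`).  The route's K-cruxes
were re-keyed at rev 31∕32 to the RE-CENTRED record ([Ax-2] `Node00/SmallFieldChi29AxOfRecord`, [Ax-3a] `Node00/Record13Ax`, [Ax-3b–d] `Node00/Record13{,CoPH,SepCoPH}Chi`: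
the Stage-13 chain re-issued GENERIC in the β-slot `χ : ChiSlot F N`, the record being the instance `χ := chiβOfRecord₁₃ θ` by `rfl`, the re-centred record the
instance `χ := chiβOfRecord₁₃Ax θ`).  The kernel-derived σ-closure of N12's junction of record (`N12-SIGMA-CLOSURE-Ax.g36.md`, evidence #2 on 27239) shows that the
(2.9) centre enters N12's whole road through exactly four definitions, one of which is `WOfRecord₁₃` (it reads `reprTOfRecord₁₃` and `gOfRecord₁₃`).  THIS FILE is
its χ-generic twin — the VERBATIM body of `Record13Carriers` :170 with `reprTOfRecord₁₃ F N θ ↦ reprTOfRecord₁₃Chi F N θ χ`, `gOfRecord₁₃ F N θ ↦ gOfRecord₁₃Chi F N θ χ`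
([Ax-3b]'s substitution list) — so that N12's leaf `B15Leaf (WOfRecord₁₃ …)` can be re-issued at `B15Leaf (WOfRecord₁₃Chi … χ …)` and read at the re-centred record.
APPEND-ONLY: a NEW importing module; `Record13Carriers`, `Record13Chi` and everything below are untouched and consumed BY NAME (body-freeze №460 (2) respected).

WHAT IS DEFINED ∕ PROVED (kernel bookkeeping, 0 sorry): `WOfRecord₁₃Chi` (def) · `WOfRecord₁₃Chi_eq` ∕ `WOfRecord₁₃Chi_LF` ∕ `WOfRecord₁₃Chi_rebindX ∕ _pinW ∕ _pinB8 ∕ _pinB12 ∕ _pinB8Sub ∕ _pinB10` (`rfl` each) · the receipt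
`WOfRecord₁₃Chi_chiβ : WOfRecord₁₃Chi θ (chiβOfRecord₁₃ θ) = WOfRecord₁₃ θ` (`rfl`) · `WOfRecord₁₃Ax` (abbrev, the instance at `chiβOfRecord₁₃Ax`) + `WOfRecord₁₃Ax_eq` (`rfl`).
HONEST FRAMING: one definition over a parameter + `rfl` receipts; NO estimate; nothing of Bałaban's analysis asserted, ported or discharged; N12 NOT discharged; K0ᴬ ∕ K1ᴬ ∕ K3ᴬ
OPEN; counts unmoved; one finite 𝕋⁴ programme at fixed `ε = L^{-K}` — NOT continuum ∕ ℝ⁴ ∕ OS; NOT the Yang–Mills mass gap (Clay).  No `sorry`, no `axiom`, no `instance`,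
no `notation`.
-/

noncomputable section

namespace Literature.MathematicalPhysics.QuantumFieldTheory.Balaban1983to89.Node00

open T4Continuum (T4Family)
open DagBinding (PrintedCarriers15 PrintedCarriersR)
open B15LeafKnitRepr (WOfRepr)
open scoped Matrix.Norms.L2Operator

section WChi

variable (F : T4Family) (N : ℕ) [NeZero N]

/-- **THE [IV] CARRIER BUNDLE OF RECORD AT STAGE 13, χ-GENERIC, run `P`** — the verbatim body of `WOfRecord₁₃` (`Record13Carriers` :170) in the β-slot `χ`: n12-a's
`WOfRepr` at the χ-generic represented tower `reprTOfRecord₁₃Chi θ χ P k`, step `k := λ.kSel P`, the selector of record at level `k + 1` along the χ-generic history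
`gOfRecord₁₃Chi θ χ P`, the fibre bonds `fibOfSeq … (gOfRecord₁₃Chi θ χ P) (k+1)`, and the residual letters `LF ∕ D189 ∕ D1100` of `λ`.
[cite: Balaban1989LargeFieldI, (0.2)–(0.6) p.176, Prop. 1 p.194, (1.89) p.198, (1.100)–(1.102) p.201 (dictionary of the pin); Balaban1988Convergent, (3.25) p.270; Balaban1987RG1, (2.9) p.266] -/
def WOfRecord₁₃Chi (θ : Stage13Params F N) (χ : ChiSlot F N) (lam : ResidW F N) (P : B12.RunParams) : PrintedCarriers15 :=
  WOfRepr (reprTOfRecord₁₃Chi F N θ χ P (lam.kSel P)) (θ.ppSel P (gOfRecord₁₃Chi F N θ χ P) (lam.kSel P + 1))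
    (fibOfSeq F θ.ν θ.τ9 P (gOfRecord₁₃Chi F N θ χ P) (lam.kSel P + 1)) (lam.LF P) (lam.D189 P) (lam.D1100 P)

/-- Unfolding (`rfl`). [cite: Balaban1989LargeFieldI, (0.2) p.176 (bookkeeping)] -/
theorem WOfRecord₁₃Chi_eq (θ : Stage13Params F N) (χ : ChiSlot F N) (lam : ResidW F N) (P : B12.RunParams) :
    WOfRecord₁₃Chi F N θ χ lam P =
      WOfRepr (reprTOfRecord₁₃Chi F N θ χ P (lam.kSel P)) (θ.ppSel P (gOfRecord₁₃Chi F N θ χ P) (lam.kSel P + 1))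
        (fibOfSeq F θ.ν θ.τ9 P (gOfRecord₁₃Chi F N θ χ P) (lam.kSel P + 1)) (lam.LF P) (lam.D189 P) (lam.D1100 P) := rfl

/-- The bundle's Proposition-1 carrier IS the residual `LF P` (`rfl`). [cite: Balaban1989LargeFieldI, Prop. 1 p.194 (bookkeeping)] -/
theorem WOfRecord₁₃Chi_LF (θ : Stage13Params F N) (χ : ChiSlot F N) (lam : ResidW F N) (P : B12.RunParams) :
    (WOfRecord₁₃Chi F N θ χ lam P).LF = lam.LF P := rfl

/-! ### The bundle under the seven carrier pins (`rfl` each: the χ-generic histories, representations, selector and fibres read no carrier — `WOfRecord₁₃_pins` clause by clause) -/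

variable (θ : Stage13Params F N) (χ : ChiSlot F N) (lam : ResidW F N)

/-- `WOfRecord₁₃Chi` is blind to the generic re-binding `rebindX` (`rfl`). [cite: Balaban1989LargeFieldI, (0.2) p.176 (bookkeeping)] -/
theorem WOfRecord₁₃Chi_rebindX (X' : B12.RunParams → PrintedCarriersR) : WOfRecord₁₃Chi F N (θ.rebindX F N X') χ lam = WOfRecord₁₃Chi F N θ χ lam := rfl

/-- `WOfRecord₁₃Chi` is blind to the W pin (`rfl`). [cite: Balaban1989LargeFieldI, (0.2) p.176 (bookkeeping)] -/
theorem WOfRecord₁₃Chi_pinW (W₀ : B12.RunParams → PrintedCarriers15) : WOfRecord₁₃Chi F N (θ.pinW F N W₀) χ lam = WOfRecord₁₃Chi F N θ χ lam := rfl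

/-- `WOfRecord₁₃Chi` is blind to the [B8] pin (`rfl`). [cite: Balaban1989LargeFieldI, (0.2) p.176 (bookkeeping)] -/
theorem WOfRecord₁₃Chi_pinB8 (lam8 : ResidB8 θ.toStage3Params) : WOfRecord₁₃Chi F N (θ.pinB8 F N lam8) χ lam = WOfRecord₁₃Chi F N θ χ lam := rfl

/-- `WOfRecord₁₃Chi` is blind to the [B12] pin (`rfl`). [cite: Balaban1989LargeFieldI, (0.2) p.176 (bookkeeping)] -/
theorem WOfRecord₁₃Chi_pinB12 (lam12 : ResidB12 F N θ.τ9.M) : WOfRecord₁₃Chi F N (θ.pinB12 F N lam12) χ lam = WOfRecord₁₃Chi F N θ χ lam := rfl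

/-- `WOfRecord₁₃Chi` is blind to the [B8]-sub pin (`rfl`). [cite: Balaban1989LargeFieldI, (0.2) p.176 (bookkeeping)] -/
theorem WOfRecord₁₃Chi_pinB8Sub (lam8 : ResidB8 θ.toStage3Params) : WOfRecord₁₃Chi F N (θ.pinB8Sub F N lam8) χ lam = WOfRecord₁₃Chi F N θ χ lam := rfl

/-- `WOfRecord₁₃Chi` is blind to the [B10] pin (`rfl`). [cite: Balaban1989LargeFieldI, (0.2) p.176 (bookkeeping)] -/
theorem WOfRecord₁₃Chi_pinB10 : WOfRecord₁₃Chi F N (θ.pinB10 F N) χ lam = WOfRecord₁₃Chi F N θ χ lam := rfl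


/-! ### §R. Receipt: the instance at `χ := chiβOfRecord₁₃ θ` IS the bundle of record -/

/-- **RECEIPT** (`rfl`, through [Ax-3b]'s `reprTOfRecord₁₃Chi_chiβ` ∕ `gOfRecord₁₃Chi_chiβ`, all definitional): at the record's own β-slot the χ-generic bundle IS
`WOfRecord₁₃`. [cite: Balaban1989LargeFieldI, (0.2) p.176; Balaban1987RG1, (2.9) p.266 (bookkeeping)] -/
theorem WOfRecord₁₃Chi_chiβ (θ : Stage13Params F N) (lam : ResidW F N) :
    WOfRecord₁₃Chi F N θ (chiβOfRecord₁₃ F N θ) lam = WOfRecord₁₃ F N θ lam := rfl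

/-! ### §A. The instance at the re-centred cut-off ([Ax-2] ∕ [Ax-3a]) -/

/-- **THE [IV] CARRIER BUNDLE OF THE RE-CENTRED RECORD**: `WOfRecord₁₃Chi` at `χ := chiβOfRecord₁₃Ax θ` — the bundle read along `gOfRecord₁₃Ax` ∕ the re-centred tower.
[cite: Balaban1989LargeFieldI, (0.2) p.176; Balaban1987RG1, (2.9) p.266, p.265 (2.3) (the block-axial centre)] -/
abbrev WOfRecord₁₃Ax (θ : Stage13Params F N) (lam : ResidW F N) (P : B12.RunParams) : PrintedCarriers15 :=
  WOfRecord₁₃Chi F N θ (chiβOfRecord₁₃Ax F N θ) lam P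

/-- Unfolding of the Ax instance along `gOfRecord₁₃Ax` (`rfl`). [cite: Balaban1989LargeFieldI, (0.2) p.176 (bookkeeping)] -/
theorem WOfRecord₁₃Ax_eq (θ : Stage13Params F N) (lam : ResidW F N) (P : B12.RunParams) :
    WOfRecord₁₃Ax F N θ lam P =
      WOfRepr (reprTOfRecord₁₃Chi F N θ (chiβOfRecord₁₃Ax F N θ) P (lam.kSel P)) (θ.ppSel P (gOfRecord₁₃Ax F N θ P) (lam.kSel P + 1))
        (fibOfSeq F θ.ν θ.τ9 P (gOfRecord₁₃Ax F N θ P) (lam.kSel P + 1)) (lam.LF P) (lam.D189 P) (lam.D1100 P) := rfl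

end WChi

end Literature.MathematicalPhysics.QuantumFieldTheory.Balaban1983to89.Node00

end
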